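import Literature.NumberTheory.Sieve.MontgomeryVaughan1975Section6B
import HarnessLib

/-!
# Montgomery–Vaughan (1975), §6 part C: the main term at one modulus, (6.10)–(6.12) — PROVED

H. L. Montgomery, R. C. Vaughan, *The exceptional set in Goldbach's problem*, Acta Arith. 27
(1975) 353–370 [MontgomeryVaughanActa1975], §6, p. 363. Third layer of the discharge of the named
fact `section6_formulae`: the main term `majorArcMainTerm` of `Section6B` at one modulus `q`.

* `charGauss_one_eq_ramanujanSum` (`c_{χ₀}(m) = c_q(m)`), `gaussSum_one_inv_eq_moebius`
  (`τ(χ̄₀) = μ(q)`), `charGauss_one_neg_natCast` (`c_q(−n) = c_q(n)`, Kluyver form) and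
  `majorArcMainTerm_eq` — **(6.12)**: `majorArcMainTerm = μ(q)² c_q(n) φ(q)⁻² · J_q`, i.e.
  `goldbachSeriesTerm n q · J_q` with `J_q = ∫_{−1/(qQ)}^{1/(qQ)} T(η)² e(−nη) dη`;
* `norm_linSum_le` — `|T(η)| ≤ 1/(2|η|)` for `0 < |η| ≤ 1/2` (geometric sum, `|e(η) − 1| ≥ 4|η|`
  by Jordan's inequality); `integral_tail_norm_linSum_sq_le` — **(6.10)**
  `∫_{h≤|η|≤1/2} |T|² ≤ 1/(2h)`;
* `pairCount`, `integral_linSum_sq_eq_pairCount` — `∫_{−1/2}^{1/2} T² e(−nη) = ν(n)`, the number of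
  `n = k + k'` with `P < k, k' ≤ X`; `abs_pairCount_sub_le` — `|ν(n) − n| ≤ 2P + 1` (`1 ≤ n ≤ X`);
* `norm_integral_linSum_sq_sub_le` — **(6.11)**: `|J_q − n| ≤ 2P + 1 + qQ/2` (`h = 1/(qQ) ≤ 1/2`).
-/

noncomputable section

open MeasureTheory Set Finset Real Complex Classical
open scoped FourierTransform ArithmeticFunction.Moebius

namespace Literature.NumberTheory.Sieve.MontgomeryVaughan1975

/-! ### The main term at `q` is `μ(q)² c_q(n) φ(q)⁻² · ∫ T² e(−nη)` -/

/-- `c_{χ₀}(m) = c_q(m)`: the Gauss sum of the principal character against `e_q(m·)` is Ramanujan's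
sum. [cite: MontgomeryVaughanActa1975, §2 (2.1)] -/
theorem charGauss_one_eq_ramanujanSum {q : ℕ} [NeZero q] (m : ℤ) :
    charGauss (1 : DirichletCharacter ℂ q) (m : ZMod q) = ramanujanSum q m := by
  have hq : 1 ≤ q := NeZero.one_le
  -- first remove the character from the sum over `1 ≤ a ≤ q`
  have h1 : ∑ a ∈ (Finset.Icc 1 q).filter (fun a : ℕ => a.Coprime q),
      (1 : DirichletCharacter ℂ q) (a : ZMod q) * (𝐞 ((a : ℝ) * m / q) : ℂ) =
      ∑ a ∈ Finset.Icc 1 q, if a.Coprime q then (𝐞 ((a : ℝ) * m / q) : ℂ) else 0 := by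
    rw [Finset.sum_filter]
    refine Finset.sum_congr rfl fun a _ => ?_
    split_ifs with ha
    · rw [MulChar.one_apply ((ZMod.isUnit_iff_coprime a q).mpr ha), one_mul]
    · rfl
  rw [← sum_coprime_char_mul_fourierChar (1 : DirichletCharacter ℂ q) m, h1, ramanujanSum_def,
    Finset.sum_filter]
  symm
  apply sum_range_eq_sum_Icc_of_apply_zero_eq _ hq
  -- the summand at `0` and at `q` agree
  by_cases hq1 : q = 1
  · subst hq1
    have e1 : (𝐞 (((0 : ℕ) : ℝ) * m / ((1 : ℕ) : ℝ)) : ℂ) = 1 := by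
      rw [show ((0 : ℕ) : ℝ) * (m : ℝ) / ((1 : ℕ) : ℝ) = 0 by push_cast; ring, AddChar.map_zero_eq_one,
        Circle.coe_one]
    have e2 : (𝐞 (((1 : ℕ) : ℝ) * m / ((1 : ℕ) : ℝ)) : ℂ) = 1 := by
      rw [show ((1 : ℕ) : ℝ) * (m : ℝ) / ((1 : ℕ) : ℝ) = ((m : ℤ) : ℝ) by push_cast; ring, RamanujanSum.fourierChar_intCast]
    rw [e1, e2]
    simp
  · have h0 : ¬ (0 : ℕ).Coprime q := by rw [Nat.coprime_zero_left]; exact hq1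
    have hq' : ¬ q.Coprime q := by rw [Nat.coprime_self]; exact hq1
    rw [if_neg h0, if_neg hq']

/-- `τ(χ̄₀) = μ(q)` for the principal character mod `q`. [cite: MontgomeryVaughanActa1975, §6 (6.2)] -/
theorem gaussSum_one_inv_eq_moebius {q : ℕ} [NeZero q] :
    gaussSum (1 : DirichletCharacter ℂ q)⁻¹ ZMod.stdAddChar = (μ q : ℂ) := by
  rw [inv_one, ← charGauss_one, ← ramanujanSum_one_right, ← charGauss_one_eq_ramanujanSum 1]
  push_cast; rfl

/-- `c_q(−n) = c_q(n)` is the real number `(μ * id·𝟙_{∣n})(q)` (Kluyver). [folklore] -/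
theorem charGauss_one_neg_natCast {q : ℕ} [NeZero q] (n : ℕ) :
    charGauss (1 : DirichletCharacter ℂ q) ((-(n : ℤ) : ℤ) : ZMod q) = (ramanujanDivisorSum n q : ℂ) := by
  rw [charGauss_one_eq_ramanujanSum, ramanujanSum_neg, ramanujanSum_eq_ramanujanDivisorSum]
  simp

/-- **The main term at `q` in arithmetic form**: `majorArcMainTerm = μ(q)² c_q(n) φ(q)⁻² · ∫ T² e(−nη)`,
i.e. `goldbachSeriesTerm n q · J_q` (Montgomery–Vaughan 1975, (6.12): "`∑ μ(q)² φ(q)⁻² c_q(−n) (…)`").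
[cite: MontgomeryVaughanActa1975, §6 (6.12)] -/
theorem majorArcMainTerm_eq {P Q X : ℝ} {n q : ℕ} (hq : q ≠ 0) :
    majorArcMainTerm P Q X n q = (goldbachSeriesTerm n q : ℂ) *
      ∫ η in (-(1 / (q * Q)))..(1 / (q * Q)), linSum P X η * linSum P X η * (𝐞 (-(n * η)) : ℂ) := by
  haveI : NeZero q := ⟨hq⟩
  rw [majorArcMainTerm, dif_neg hq, gaussSum_one_inv_eq_moebius, charGauss_one_neg_natCast,
    goldbachSeriesTerm_apply]
  push_cast
  ring

/-! ### `T(η)`: the window as an interval, the geometric-sum bound, and the tails (6.10) -/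

/-- The window of `T` is the interval `(⌊P⌋, ⌊X⌋]`. [folklore] -/
theorem intWindow_eq_Ioc {P X : ℝ} (hP : 0 ≤ P) : intWindow P X = Finset.Ioc ⌊P⌋₊ ⌊X⌋₊ := by
  ext k
  rw [mem_intWindow, Finset.mem_Ioc, Nat.floor_lt hP]
  constructor
  · rintro ⟨⟨h1, h2⟩, h3⟩; exact ⟨h3, h2⟩
  · rintro ⟨h1, h2⟩
    refine ⟨⟨?_, h2⟩, h1⟩
    have : (0 : ℝ) < k := hP.trans_lt h1
    exact_mod_cast this

/-- `T(η)` as a geometric sum: `T(η) = ∑_{⌊P⌋ < k ≤ ⌊X⌋} e(η)^k`. [folklore] -/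
theorem linSum_eq_geom {P X : ℝ} (hP : 0 ≤ P) (η : ℝ) :
    linSum P X η = ∑ k ∈ Finset.Ico (⌊P⌋₊ + 1) (⌊X⌋₊ + 1), ((𝐞 η : ℂ)) ^ k := by
  rw [linSum, intWindow_eq_Ioc hP, show Finset.Ioc ⌊P⌋₊ ⌊X⌋₊ = Finset.Ico (⌊P⌋₊ + 1) (⌊X⌋₊ + 1) by
    ext k; simp only [Finset.mem_Ioc, Finset.mem_Ico]; omega]
  refine Finset.sum_congr rfl fun k _ => ?_
  rw [← Circle.coe_pow, ← AddChar.map_nsmul_eq_pow, nsmul_eq_mul]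

/-- `|e(η) − 1| = 2|sin(πη)| ≥ 4|η|` for `|η| ≤ 1/2` (Jordan). [folklore] -/
theorem four_mul_abs_le_norm_fourierChar_sub_one {η : ℝ} (hη : |η| ≤ 1 / 2) :
    4 * |η| ≤ ‖(𝐞 η : ℂ) - 1‖ := by
  have h1 : ‖(𝐞 η : ℂ) - 1‖ = ‖2 * Real.sin (2 * π * η / 2)‖ := by
    rw [Real.fourierChar_apply, show ((2 * π * η : ℝ) : ℂ) * I = I * ((2 * π * η : ℝ) : ℂ) by ring,
      Complex.norm_exp_I_mul_ofReal_sub_one]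
  rw [h1, show 2 * π * η / 2 = π * η by ring, Real.norm_eq_abs, abs_mul, abs_two]
  -- Jordan on `|πη| ≤ π/2`: `sin |πη| ≥ (2/π)|πη| = 2|η|`
  have hθ : |π * η| ≤ π / 2 := by
    rw [abs_mul, abs_of_pos Real.pi_pos]
    calc π * |η| ≤ π * (1 / 2) := by gcongr
      _ = π / 2 := by ring
  have hj : 2 / π * |π * η| ≤ Real.sin |π * η| := Real.mul_le_sin (abs_nonneg _) hθ
  have hs : Real.sin |π * η| = |Real.sin (π * η)| := by
    rcases le_or_gt 0 (π * η) with h | h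
    · rw [abs_of_nonneg h, abs_of_nonneg (Real.sin_nonneg_of_nonneg_of_le_pi h (by linarith [abs_le.mp hθ]))]
    · rw [abs_of_neg h, Real.sin_neg, abs_of_neg (Real.sin_neg_of_neg_of_neg_pi_lt h (by linarith [abs_le.mp hθ]))]
  have : 2 / π * |π * η| = 2 * |η| := by
    rw [abs_mul, abs_of_pos Real.pi_pos]; field_simp
  rw [this] at hj
  linarith [hj, hs.symm.le, hs.le]

/-- **`|T(η)| ≤ 1/(2|η|)`** for `0 < |η| ≤ 1/2` (p. 363: "`T(η) ≪ ‖η‖⁻¹`"). [cite: MontgomeryVaughanActa1975, §6 (6.10)] -/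
theorem norm_linSum_le {P X η : ℝ} (hP : 0 ≤ P) (hη0 : η ≠ 0) (hη : |η| ≤ 1 / 2) :
    ‖linSum P X η‖ ≤ 1 / (2 * |η|) := by
  have hz1 : (𝐞 η : ℂ) ≠ 1 := by
    intro h
    have := four_mul_abs_le_norm_fourierChar_sub_one hη
    rw [h, sub_self, norm_zero] at this
    have : |η| = 0 := by linarith [abs_nonneg η]
    exact hη0 (abs_eq_zero.mp this)
  have hbound0 : (0 : ℝ) ≤ 1 / (2 * |η|) := by positivity
  rw [linSum_eq_geom hP]
  by_cases hle : ⌊P⌋₊ + 1 ≤ ⌊X⌋₊ + 1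
  swap
  · rw [Finset.Ico_eq_empty_of_le (by omega), Finset.sum_empty, norm_zero]; exact hbound0
  rw [geom_sum_Ico hz1 hle, norm_div]
  have hnum : ‖(𝐞 η : ℂ) ^ (⌊X⌋₊ + 1) - (𝐞 η : ℂ) ^ (⌊P⌋₊ + 1)‖ ≤ 2 := by
    refine (norm_sub_le _ _).trans ?_
    rw [norm_pow, norm_pow, Circle.norm_coe, one_pow, one_pow]; norm_num
  have hden := four_mul_abs_le_norm_fourierChar_sub_one hη
  have hpos : 0 < 4 * |η| := by positivity
  rw [div_le_div_iff₀ (lt_of_lt_of_le hpos hden) (by positivity)]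
  nlinarith [norm_nonneg ((𝐞 η : ℂ) ^ (⌊X⌋₊ + 1) - (𝐞 η : ℂ) ^ (⌊P⌋₊ + 1))]

/-- `∫_a^b (1/(2η))² dη ≤ 1/(4a)` for `0 < a ≤ b`. [folklore] -/
theorem integral_inv_two_mul_sq_le {a b : ℝ} (ha : 0 < a) (hab : a ≤ b) :
    ∫ η in a..b, (1 / (2 * |η|)) ^ 2 ≤ 1 / (4 * a) := by
  have h0 : (0 : ℝ) ∉ Set.uIcc a b := by
    rw [Set.uIcc_of_le hab]; intro h; exact absurd h.1 (not_le.mpr ha)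
  have heq : ∫ η in a..b, (1 / (2 * |η|)) ^ 2 = (1 / 4) * ∫ η in a..b, η ^ (-2 : ℤ) := by
    rw [← intervalIntegral.integral_const_mul]
    refine intervalIntegral.integral_congr fun η hη => ?_
    rw [Set.uIcc_of_le hab] at hη
    have hη0 : 0 < η := ha.trans_le hη.1
    rw [abs_of_pos hη0, zpow_neg, zpow_two]
    field_simp
    ring
  rw [heq, integral_zpow (Or.inr ⟨by norm_num, h0⟩)]
  norm_num
  have hb : 0 < b := ha.trans_le hab
  have hb' : (0 : ℝ) ≤ b⁻¹ := by positivity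
  have ha' : a⁻¹ = 1 / a := inv_eq_one_div a
  nlinarith [hb', ha']

/-- **(6.10)** the tails: `∫_{h}^{1/2} |T|² ≤ 1/(4h)` and the same on `[−1/2, −h]`, for `0 < h ≤ 1/2`.
[cite: MontgomeryVaughanActa1975, §6 (6.10)] -/
theorem integral_tail_norm_linSum_sq_le {P X h : ℝ} (hP : 0 ≤ P) (hh : 0 < h) (hh2 : h ≤ 1 / 2) :
    (∫ η in h..(1 / 2 : ℝ), ‖linSum P X η‖ ^ 2) ≤ 1 / (4 * h) ∧
      (∫ η in (-(1 / 2 : ℝ))..(-h), ‖linSum P X η‖ ^ 2) ≤ 1 / (4 * h) := by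
  have hcont : Continuous fun η : ℝ => ‖linSum P X η‖ ^ 2 := by unfold linSum; fun_prop
  have hpt : ∀ η : ℝ, h ≤ |η| → |η| ≤ 1 / 2 → ‖linSum P X η‖ ^ 2 ≤ (1 / (2 * |η|)) ^ 2 := by
    intro η h1 h2
    have hη0 : η ≠ 0 := by intro h0; rw [h0, abs_zero] at h1; linarith
    exact pow_le_pow_left₀ (norm_nonneg _) (norm_linSum_le hP hη0 h2) 2
  have hcont2 : ContinuousOn (fun η : ℝ => (1 / (2 * |η|)) ^ 2) (Set.Icc h (1 / 2)) := by
    refine ContinuousOn.pow (continuousOn_const.div (by fun_prop) fun η hη => ?_) 2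
    have : 0 < η := hh.trans_le hη.1
    positivity
  constructor
  · calc ∫ η in h..(1 / 2 : ℝ), ‖linSum P X η‖ ^ 2 ≤ ∫ η in h..(1 / 2 : ℝ), (1 / (2 * |η|)) ^ 2 := by
          apply intervalIntegral.integral_mono_on hh2 (hcont.intervalIntegrable _ _)
            (hcont2.intervalIntegrable_of_Icc hh2)
          intro η hη
          exact hpt η (by rw [abs_of_pos (hh.trans_le hη.1)]; exact hη.1)
            (by rw [abs_of_pos (hh.trans_le hη.1)]; exact hη.2)
      _ ≤ 1 / (4 * h) := integral_inv_two_mul_sq_le hh hh2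
  · -- reflect `η ↦ −η`
    have hsymm : ∫ η in (-(1 / 2 : ℝ))..(-h), ‖linSum P X η‖ ^ 2 =
        ∫ η in h..(1 / 2 : ℝ), ‖linSum P X (-η)‖ ^ 2 := by
      rw [← intervalIntegral.integral_comp_neg fun η => ‖linSum P X η‖ ^ 2]
    rw [hsymm]
    have hcont' : Continuous fun η : ℝ => ‖linSum P X (-η)‖ ^ 2 := by unfold linSum; fun_prop
    calc ∫ η in h..(1 / 2 : ℝ), ‖linSum P X (-η)‖ ^ 2 ≤ ∫ η in h..(1 / 2 : ℝ), (1 / (2 * |η|)) ^ 2 := by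
          apply intervalIntegral.integral_mono_on hh2 (hcont'.intervalIntegrable _ _)
            (hcont2.intervalIntegrable_of_Icc hh2)
          intro η hη
          have := hpt (-η) (by rw [abs_neg, abs_of_pos (hh.trans_le hη.1)]; exact hη.1)
            (by rw [abs_neg, abs_of_pos (hh.trans_le hη.1)]; exact hη.2)
          rwa [abs_neg] at this
      _ ≤ 1 / (4 * h) := integral_inv_two_mul_sq_le hh hh2

/-! ### (6.11): `J_q = ∫_{−1/(qQ)}^{1/(qQ)} T² e(−nη) = ν(n) + O(qQ)`, `ν(n) = n + O(P)` -/

/-- The number of representations `n = k + k'` with `P < k, k' ≤ X`. [folklore] -/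
def pairCount (P X : ℝ) (n : ℕ) : ℕ :=
  ((intWindow P X ×ˢ intWindow P X).filter fun p : ℕ × ℕ => p.1 + p.2 = n).card

/-- `∫_{−1/2}^{1/2} T(η)² e(−nη) dη = ν(n)` (orthogonality). [cite: MontgomeryVaughanActa1975, §6 (6.11)] -/
theorem integral_linSum_sq_eq_pairCount (P X : ℝ) (n : ℕ) :
    ∫ η in (-(1 / 2 : ℝ))..(-(1 / 2 : ℝ)) + 1, linSum P X η * linSum P X η * (𝐞 (-(n * η)) : ℂ) =
      (pairCount P X n : ℂ) := by
  have h := integral_trigPoly_mul_trigPoly (intWindow P X) (intWindow P X) (fun _ => (1 : ℂ))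
    (fun _ => (1 : ℂ)) (-(1 / 2 : ℝ)) n
  simp only [one_mul] at h
  have hT : ∀ η : ℝ, linSum P X η = ∑ k ∈ intWindow P X, (𝐞 (k * η) : ℂ) := fun η => rfl
  simp_rw [hT]
  rw [h, pairCount, Finset.card_filter, Nat.cast_sum, Finset.sum_product]
  refine Finset.sum_congr rfl fun k₁ _ => Finset.sum_congr rfl fun k₂ _ => ?_
  split_ifs <;> simp

/-- `ν(n) ≤ n`: the first summand determines the pair and lies in `[1, n]`. [folklore] -/
theorem pairCount_le (P X : ℝ) (n : ℕ) : pairCount P X n ≤ n := by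
  rw [pairCount]
  calc ((intWindow P X ×ˢ intWindow P X).filter fun p : ℕ × ℕ => p.1 + p.2 = n).card
      ≤ (Finset.Icc 1 n).card := by
        refine Finset.card_le_card_of_injOn Prod.fst (fun p hp => ?_) (fun p hp p' hp' h => ?_)
        · rw [Finset.mem_coe, Finset.mem_filter, Finset.mem_product, mem_intWindow] at hp
          rw [Finset.mem_coe, Finset.mem_Icc]
          exact ⟨hp.1.1.1.1, by omega⟩
        · rw [Finset.mem_coe, Finset.mem_filter] at hp hp'
          have h2 : p.2 = p'.2 := by omega
          exact Prod.ext h h2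
    _ = n := by simp

/-- `ν(n) ≥ n − 2⌊P⌋ − 1` for `n ≤ ⌊X⌋`: every `⌊P⌋ < k ≤ n − ⌊P⌋ − 1` gives a pair. [folklore] -/
theorem sub_le_pairCount {P X : ℝ} (hP : 0 ≤ P) {n : ℕ} (hn : n ≤ ⌊X⌋₊) :
    n - 2 * ⌊P⌋₊ - 1 ≤ pairCount P X n := by
  rw [pairCount]
  have hcard : (Finset.Ioc ⌊P⌋₊ (n - ⌊P⌋₊ - 1)).card = n - 2 * ⌊P⌋₊ - 1 := by
    rw [Nat.card_Ioc]; omega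
  rw [← hcard]
  refine Finset.card_le_card_of_injOn (fun k => (k, n - k)) (fun k hk => ?_) (fun k _ k' _ h => ?_)
  · rw [Finset.mem_coe, Finset.mem_Ioc] at hk
    simp only [Finset.mem_coe, Finset.mem_filter, Finset.mem_product, intWindow_eq_Ioc hP, Finset.mem_Ioc]
    omega
  · exact (Prod.ext_iff.mp h).1

/-- `|ν(n) − n| ≤ 2P + 1` for `1 ≤ n ≤ X`. [cite: MontgomeryVaughanActa1975, §6 (6.11)] -/
theorem abs_pairCount_sub_le {P X : ℝ} (hP : 0 ≤ P) {n : ℕ} (hnX : (n : ℝ) ≤ X) :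
    |(pairCount P X n : ℝ) - n| ≤ 2 * P + 1 := by
  have hn : n ≤ ⌊X⌋₊ := Nat.le_floor hnX
  have h1 := pairCount_le P X n
  have h2 := sub_le_pairCount hP hn
  have hPf : (⌊P⌋₊ : ℝ) ≤ P := Nat.floor_le hP
  rw [abs_le]
  constructor
  · -- `ν ≥ n − 2⌊P⌋ − 1`
    have : (n : ℝ) - 2 * ⌊P⌋₊ - 1 ≤ pairCount P X n := by
      have h3 : ((n - 2 * ⌊P⌋₊ - 1 : ℕ) : ℝ) ≤ pairCount P X n := by exact_mod_cast h2
      refine le_trans ?_ h3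
      rcases le_or_gt (2 * ⌊P⌋₊ + 1) n with hle | hlt
      · rw [show n - 2 * ⌊P⌋₊ - 1 = n - (2 * ⌊P⌋₊ + 1) by omega, Nat.cast_sub hle]
        push_cast; linarith
      · have h0 : ((n - 2 * ⌊P⌋₊ - 1 : ℕ) : ℝ) = 0 := by
          rw [show n - 2 * ⌊P⌋₊ - 1 = 0 by omega]; simp
        rw [h0]
        have : (n : ℝ) < 2 * ⌊P⌋₊ + 1 := by exact_mod_cast hlt
        linarith
    linarith
  · have : (pairCount P X n : ℝ) ≤ n := by exact_mod_cast h1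
    linarith

/-- The norm of the integrand `T² e(−nη)` is `|T|²`. [folklore] -/
theorem norm_linSum_mul_linSum_mul (P X : ℝ) (n : ℕ) (η : ℝ) :
    ‖linSum P X η * linSum P X η * (𝐞 (-(n * η)) : ℂ)‖ = ‖linSum P X η‖ ^ 2 := by
  rw [norm_mul, norm_mul, Circle.norm_coe, mul_one, sq]

/-- **(6.11)**: `|∫_{−h}^{h} T(η)² e(−nη) dη − n| ≤ 2P + 1 + 1/(2h)` for `0 < h ≤ 1/2`, `1 ≤ n ≤ X`
(the unit-interval integral is `ν(n) = n + O(P)`, the tails are `O(1/h)` by (6.10)).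
[cite: MontgomeryVaughanActa1975, §6 (6.11)] -/
theorem norm_integral_linSum_sq_sub_le {P X h : ℝ} (hP : 0 ≤ P) (hh : 0 < h) (hh2 : h ≤ 1 / 2)
    {n : ℕ} (hnX : (n : ℝ) ≤ X) :
    ‖(∫ η in (-h)..h, linSum P X η * linSum P X η * (𝐞 (-(n * η)) : ℂ)) - (n : ℂ)‖ ≤
      2 * P + 1 + 1 / (2 * h) := by
  set F : ℝ → ℂ := fun η => linSum P X η * linSum P X η * (𝐞 (-(n * η)) : ℂ) with hF
  have hFc : Continuous F := by rw [hF]; unfold linSum; fun_prop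
  have hii : ∀ a b : ℝ, IntervalIntegrable F volume a b := fun a b => hFc.intervalIntegrable a b
  -- split the unit interval at `±h`
  have hfull : ∫ η in (-(1 / 2 : ℝ))..(1 / 2 : ℝ), F η = (pairCount P X n : ℂ) := by
    have h := integral_linSum_sq_eq_pairCount P X n
    rw [show -(1 / 2 : ℝ) + 1 = 1 / 2 by norm_num] at h
    exact h
  have hsplit : ∫ η in (-(1 / 2 : ℝ))..(1 / 2 : ℝ), F η =
      (∫ η in (-(1 / 2 : ℝ))..(-h), F η) + (∫ η in (-h)..h, F η) + ∫ η in h..(1 / 2 : ℝ), F η := by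
    rw [intervalIntegral.integral_add_adjacent_intervals (hii _ _) (hii _ _),
      intervalIntegral.integral_add_adjacent_intervals (hii _ _) (hii _ _)]
  have hmid : (∫ η in (-h)..h, F η) - (n : ℂ) =
      ((pairCount P X n : ℂ) - n) - (∫ η in (-(1 / 2 : ℝ))..(-h), F η) - ∫ η in h..(1 / 2 : ℝ), F η := by
    rw [← hfull, hsplit]; ring
  -- the tails
  obtain ⟨ht1, ht2⟩ := integral_tail_norm_linSum_sq_le (P := P) (X := X) hP hh hh2
  have hright : ‖∫ η in h..(1 / 2 : ℝ), F η‖ ≤ 1 / (4 * h) := by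
    refine (intervalIntegral.norm_integral_le_integral_norm hh2).trans ?_
    simp only [hF, norm_linSum_mul_linSum_mul]
    exact ht1
  have hleft : ‖∫ η in (-(1 / 2 : ℝ))..(-h), F η‖ ≤ 1 / (4 * h) := by
    refine (intervalIntegral.norm_integral_le_integral_norm (by linarith)).trans ?_
    simp only [hF, norm_linSum_mul_linSum_mul]
    exact ht2
  have hν : ‖(pairCount P X n : ℂ) - n‖ ≤ 2 * P + 1 := by
    rw [show (pairCount P X n : ℂ) - n = (((pairCount P X n : ℝ) - n : ℝ) : ℂ) by push_cast; ring,
      Complex.norm_real, Real.norm_eq_abs]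
    exact abs_pairCount_sub_le hP hnX
  rw [show (∫ η in (-h)..h, linSum P X η * linSum P X η * (𝐞 (-(n * η)) : ℂ)) = ∫ η in (-h)..h, F η
    from rfl, hmid]
  have e1 := norm_sub_le (((pairCount P X n : ℂ) - n) - ∫ η in (-(1 / 2 : ℝ))..(-h), F η)
    (∫ η in h..(1 / 2 : ℝ), F η)
  have e2 := norm_sub_le ((pairCount P X n : ℂ) - n) (∫ η in (-(1 / 2 : ℝ))..(-h), F η)
  have e3 : 1 / (4 * h) + 1 / (4 * h) = 1 / (2 * h) := by field_simp; ring
  linarith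

end Literature.NumberTheory.Sieve.MontgomeryVaughan1975
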